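import Summits.AtomisticToContinuum.HydrodynamicLimit.Theses.AnnealedZeroHorizon
import Literature.Analysis.FluidPDE.CollisionalTransferTimeDep
import Summits.AtomisticToContinuum.HydrodynamicLimit.Theorems.AnnealedZeroHorizonMeanFluxClosureDeviatoricStressClosureB

/-!
# Skeleton for crux `MeanMomentumClosureCut` — route AnnealedZeroHorizon, item stmt-AtomisticToContinuum-18014
# line `balance-split` (strategist, 2026-08-17): kinetic ∥ collisional split of the ANNEALED kernel-format
# momentum-flux closure, the exact space–time momentum balance of the hard-sphere flow as the seam

The crux (re-typed 2026-08-17; annealed, continuous macroscopic kernels, cut pressure, smooth space–time test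
fields, uniform in `τ ∈ [0,T₁]`, UNTIED and all-time) asserts: `Integrable D ∧ |E D| ≤ ε` eventually in `N`,
where `D(z) = ⟨m^k(τ), w(τ)⟩ − ⟨m^k(0), w(0)⟩ − ∫_{(0,τ]}∫ (m^k·∂ₜw + (m^k⊗m^k/ρ^k):∇w + p_cut div w)` is the
pathwise weak momentum-balance defect of the `k`-mollified empirical fields. For every GOOD datum `z`
(hard-sphere trajectory) the weak balance law for the TIME-DEPENDENT observable
`F t z' = (N+1)⁻¹ Σ_a ⟪(k̃ ⋆ w(t))(q_a), v_a⟫` (`k̃ ⋆ w(t) (q) = ∫ k(x − q) w(t,x) dx`;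
`Literature.Analysis.FluidPDE.IsHardSphereTrajectory.sub_eq_integral_add_finsum_collisionJump_td`) gives
EXACTLY

  `D z = CollDev z + KinDev z`,
  `KinDev z  = ∫_{(0,τ]}∫ Σᵢⱼ (S^k − m^k⊗m^k/ρ^k − ρ^kθ^k 𝟙)ᵢⱼ ∂ⱼwᵢ`      (traceless window velocity covariance
                                                                       against ∇w; `S^k` the mollified kinetic stress)
  `CollDev z = C_w(z) − ∫_{(0,τ]}∫ ρ^kθ^k (Z(min(ρ^kσ³,η₁)) − 1) div w`   (collisional momentum transfer of the
                                                                       frozen-time observables minus the CUT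
                                                                       excess-pressure work),

because in the kernel format the streaming term is exact (`∇(k̃ ⋆ w) = k̃ ⋆ ∇w`: NO streaming commutator, unlike
the raw-field format of the dropped `MeanFluxClosure`, whose KS-a was a separate landed stub p144915) and the trace
of `S^k` is `2E^k = |m^k|²/ρ^k + 3ρ^kθ^k` BY DEFINITION of `θ^k`. Hence the crux is the sum, in mean, of

* stub BAL `stub_kernelMomentumBalance` — the identity above on the good set (finite `N`, every `σ, η₁`, every
  continuous probability kernel, every `τ ∈ [0,T')`; provable bookkeeping, size M–L: the kernel twin of the LANDED
  `Theorems.FluxClosureGlue.boxMomentumBalance`, p150403, of route BoxDissipativeWeakStrong);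
* stub KIN `stub_kineticDeviatorMean` — `Integrable KinDev ∧ |E KinDev| ≤ ε` in the crux's quantifier frame WITHOUT
  the band (kinetic, EOS-free): ANNEALED KINETIC ISOTROPY at macroscopic resolution — the (D1)-kinetic half;
* stub COLL `stub_collisionalCutVirialMean` — `Integrable CollDev ∧ |E CollDev| ≤ ε` in the crux's frame with the
  band `∃ η_c ∀ η₁ < η_c`: ANNEALED CUT VIRIAL CLOSURE — the (D1)-collisional half (carries the band/rattler issue);

and the glue `parts_imply_meanMomentumClosureCut : BAL → KIN → COLL → MeanMomentumClosureCut` is PROVED below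
(thresholds `η_c` from COLL, `σ₀ := min`, `ℓ := min`, `∀ᶠ` intersected, `ε/2 + ε/2`; the split holds
`P_N`-a.e. because `localGibbsLaw ≪ Liouville` is carried by the good set,
`Theorems.DeviatoricStressClosure.ae_mem_good_localGibbsLaw`; then `Integrable.congr` + `integral_add` + the
triangle inequality — no inner integral is ever split in the glue). `MeanMomentumClosureCut_of` concludes the
crux BY NAME; its only `sorryAx` dependence is through the three `stub_*`.

Relation to existing work (dedup map): KIN/COLL are the annealed (plain mean instead of `L¹(P_N)`),
macroscopic-continuous-kernel (`ℓ` fixed as `N → ∞`, then `ℓ → 0`, instead of kinetic cubes `ℓ_N → 0`) and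
UNTIED/all-time twins of `stub_kineticIsotropy` / `stub_collisionalVirial` of `Cruxes/FluxClosure/Lines/birth.lean`
(stmt-9902); KIN is the space–time form of the dropped line's KS-b `stub_deviatoricStressClosure` (stmt-9256; its
landed pieces `Theorems/AnnealedZeroHorizonMeanFluxClosureDeviatoricStressClosure{,B,C}.lean` — exact scale-ℓ
identity, fixed-`N` integrability, equilibrium case — transfer after the routine time-slice ↦ space–time rewrite),
COLL that of CS `stub_collisionalStressClosure` with the cut (`…CollisionalStressClosure{,B,C,D}`,
`…CollisionalVirialClosure{,B,C}` transfer likewise). Card: `Lines/balance-split.md`; census: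
`Cruxes/MeanMomentumClosureCut/STRATEGY-CENSUS.md`.
-/

namespace Summit.AtomisticToContinuum.HydrodynamicLimit.Cruxes.MeanMomentumClosureCut.BalanceSplit

open scoped BigOperators Topology Classical MeasureTheory ProbabilityTheory InnerProductSpace ENNReal
open Filter Set Function MeasureTheory
open Literature.MathematicalPhysics.KineticTheory Literature.Analysis.FluidPDE Literature.Analysis.FunctionSpaces
open Summit.AtomisticToContinuum.HydrodynamicLimit.Theses.AnnealedZeroHorizon

/-- stub BAL — EXACT KERNEL-FORMAT SPACE–TIME MOMENTUM BALANCE IN SPLIT FORM (finite `N`; bookkeeping, provable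
now, size M–L). For every reduced diameter `σ`, band parameter `η₁`, horizon `T'`, profile functions, flow family
`Φ`, continuous probability kernel `k`, smooth space–time field `w` on `[0,T') × 𝕋³`, `τ ∈ [0,T')` and `N`: for
every GOOD datum `z` of `Φ N` the crux's defect `D z` equals `CollDev z + KinDev z`. Why true: the weak balance law
for the time-dependent observable `F t z' = (N+1)⁻¹ momentumObservable (k̃ ⋆ w(t)) z'` along the trajectory of `z`
(`IsHardSphereTrajectory.sub_eq_integral_add_finsum_collisionJump_td`; streaming derivative
`(N+1)⁻¹ Σ_a [⟪(k̃ ⋆ ∂ₜw)(q_a), v_a⟫ + ⟪D(k̃ ⋆ w(t))(q_a) v_a, v_a⟫]`, `D(k̃ ⋆ w) = k̃ ⋆ Dw` by differentiation under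
the integral for continuous compactly supported `k`), Fubini over the `N+1` particles (`∫ x, ⟪Mv, w⟫ = (N+1)⁻¹
momentumObservable (k̃ ⋆ w)`, `∫ x, Σᵢⱼ S^kᵢⱼ ∂ⱼwᵢ = (N+1)⁻¹ momentumStreaming (k̃ ⋆ w)`), linearity of
`∫_{(0,τ]}∫` at a fixed good `z` (continuous bounded integrands on a compact torus; `|m^k⊗m^k/ρ^k| ≤ 2E^k`), the
algebra `p_cut = ρθ + ρθ(Z_cut − 1)` and `Σᵢⱼ δᵢⱼ ρθ ∂ⱼwᵢ = ρθ div w` (`Torus.divergence` unfolds). Kernel twin of the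
LANDED `Theorems.FluxClosureGlue.boxMomentumBalance` (p150403; pieces B1–B5 p148590 p148466 p148547 p148905 p148134)
with the cube indicator replaced by a continuous kernel (easier: `k̃ ⋆ w(t)` is `C¹` with no boundary layer). Leans
on: `collisionTimes`, `collisionJump`, `momentumObservable`, `momentumStreaming`, `empiricalMeasure`,
`empirical{Density,Momentum,Energy}Field`, `HardSphereFlow.good/isTrajectory`, `Torus.partialDeriv/divergence/
timeDerivWithin`. -/
theorem stub_kernelMomentumBalance : ∀ (σ η₁ T' : ℝ) (a₀ θ₀ : T3 → ℝ) (u₀ : T3 → V3) (Φ : (N : ℕ) → HardSphereFlow (Torus.geometry (Fin 3)) (hsDiameter σ N) (N + 1)) (k : T3 → ℝ), Continuous k → (∀ y, 0 ≤ k y) → (∫ y, k y = 1) → ∀ w : ℝ → T3 → V3, Torus.IsSmoothSpaceTimeOn (Ico 0 T') w → ∀ τ ∈ Ico 0 T', ∀ N : ℕ, let R := fun s z x => empiricalDensityField ((Φ N).flow s z) (fun y => k (x - y)); let Mv := fun s z x => empiricalMomentumField ((Φ N).flow s z) (fun y => k (x - y)); let En := fun s z x => empiricalEnergyField ((Φ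 N).flow s z) (fun y => k (x - y)); let Sk := fun s z x (i j : Fin 3) => ∫ y, k (x - y.1) * (y.2 i * y.2 j) ∂(empiricalMeasure ((Φ N).flow s z)); let D : Config (N + 1) (Fin 3) T3 → ℝ := fun z => (∫ x, inner ℝ (Mv τ z x) (w τ x)) - (∫ x, inner ℝ (Mv 0 z x) (w 0 x)) - ∫ s in Ioc 0 τ, ∫ x, (inner ℝ (Mv s z x) (Torus.timeDerivWithin (Ico 0 T') w s x) + (∑ i, ∑ j, Mv s z x i * Mv s z x j / R s z x * Torus.partialDeriv j (fun y => w s y i) x) + R s z x * (2 / 3 * (En s z x / R s z x - ‖Mv s z x‖ ^ 2 / (2 * R s z x ^ 2))) * hsCompressibility (min (R s z x * σ ^ 3) η₁) * Torus.divergence (w s) x); let KinDev : Config (N + 1) (Fin 3) T3 → ℝ := fun z => ∫ s in Ioc 0 τ, ∫ x, ∑ i, ∑ j, (Sk s z x i j - Mv s z x i * Mv s z x j / R s z x - (if i = j then R s z x * (2 / 3 * (En s z x / R s z x - ‖Mv s z x‖ ^ 2 / (2 * R s z x ^ 2))) else 0)) * Torus.partialDeriv j (fun y => w s y i) x; let Cw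 : Config (N + 1) (Fin 3) T3 → ℝ := fun z => ∑ᶠ t ∈ collisionTimes (Torus.geometry (Fin 3)) (hsDiameter σ N) (fun s => (Φ N).flow s z) ∩ Ioc 0 τ, collisionJump (fun z' : Config (N + 1) (Fin 3) T3 => ((N + 1 : ℕ) : ℝ)⁻¹ * momentumObservable (fun q => ∫ x, k (x - q) • w t x) z') (fun s => (Φ N).flow s z) t; let CollDev : Config (N + 1) (Fin 3) T3 → ℝ := fun z => Cw z - ∫ s in Ioc 0 τ, ∫ x, R s z x * (2 / 3 * (En s z x / R s z x - ‖Mv s z x‖ ^ 2 / (2 * R s z x ^ 2))) * (hsCompressibility (min (R s z x * σ ^ 3) η₁) - 1) * Torus.divergence (w s) x; ∀ z ∈ (Φ N).good, D z = CollDev z + KinDev z := by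
  sorry

/-- stub KIN — ANNEALED KINETIC ISOTROPY AT MACROSCOPIC RESOLUTION (the (D1)-kinetic half; hardest). For all
continuous positive profiles there is `σ₀` such that for `0 < σ < σ₀`, every flow family, horizon `T' > 0`,
smooth space–time vector field `w` on `[0,T') × 𝕋³`, `T₁ < T'` and `ε > 0` there is `ℓ > 0` with: for every
continuous probability kernel supported in the `ℓ`-ball, eventually in `N`, for all `τ ∈ [0,T₁]`, the
space–time average against `∇w` of the TRACELESS WINDOW VELOCITY COVARIANCE
`KinDev(z) = ∫_{(0,τ]}∫ Σᵢⱼ (S^k − m^k⊗m^k/ρ^k − ρ^kθ^k𝟙)ᵢⱼ ∂ⱼwᵢ dx ds` (`S^kᵢⱼ(x) = (N+1)⁻¹Σ_a k(x−q_a)v_aⁱv_aʲ`;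
its trace is `2E^k`, so only the anisotropic part is claimed small; no `η₁`, no equation of state) is integrable
under the local Gibbs law with `|E KinDev| ≤ ε`. Why plausibly true: local Maxwellians have isotropic second
moments, `Kn_N ≍ σ⁻²(N+1)^{-1/3} → 0`, and only the law-averaged, space–time-integrated second moment is asked;
at constant profiles it holds exactly (`E KinDev = 0` for every `N`: stationarity + translation invariance,
landed for time slices as `Theorems.stub_deviatoricStressClosure_equilibrium`). Why it might fail: no mixing
theorem for deterministic spheres (Spohn1991 §3.3; OllaVaradhanYau1993 need noise;
`Literature.Barriers.AtomisticToContinuum.BoltzmannHypothesisBarrierNarrow` kernel (4): any proof must use the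
collisions quantitatively — for free flight the analogue is false by phase mixing); and in the UNTIED all-time
frame the claim must also absorb the sub-kernel Reynolds stress of post-shock / post-slip-surface flow as
`ℓ → 0` after `N → ∞` (route X₋'s own mechanism) — see the census §Frame. Size: open-problem. Provable parts to
land first (`--supports`): the exact identity `KinDev`-integrand = traceless peculiar covariance ⋅ ∇w (time-slice
form landed: `stub_deviatoricStressClosure_identity`), fixed-`N` integrability with the bound `19 C τ B₁`
(`…_integrable`), the equilibrium case (`…_equilibrium`). -/
theorem stub_kineticDeviatorMean : ∀ (a₀ θ₀ : T3 → ℝ) (u₀ : T3 → V3), Continuous a₀ → Continuous θ₀ → Continuous u₀ → (∀ x, 0 < a₀ x) → (∀ x, 0 < θ₀ x) → ∃ σ₀ : ℝ, 0 < σ₀ ∧ ∀ σ : ℝ, 0 < σ → σ < σ₀ → ∀ Φ : (N : ℕ) → HardSphereFlow (Torus.geometry (Fin 3)) (hsDiameter σ N) (N + 1), ∀ T' : ℝ, 0 < T' → ∀ w : ℝ → T3 → V3, Torus.IsSmoothSpaceTimeOn (Ico 0 T') w → ∀ T₁ : ℝ, 0 ≤ T₁ → T₁ < T' → ∀ ε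 : ℝ, 0 < ε → ∃ ℓ : ℝ, 0 < ℓ ∧ ∀ k : T3 → ℝ, (Continuous k ∧ (∀ y, 0 ≤ k y) ∧ (∫ y, k y = 1) ∧ (∀ y, k y ≠ 0 → Torus.euclidDist y 0 < ℓ)) → ∀ᶠ N in atTop, ∀ τ ∈ Icc 0 T₁, let R := fun s z x => empiricalDensityField ((Φ N).flow s z) (fun y => k (x - y)); let Mv := fun s z x => empiricalMomentumField ((Φ N).flow s z) (fun y => k (x - y)); let En := fun s z x => empiricalEnergyField ((Φ N).flow s z) (fun y => k (x - y)); let Sk := fun s z x (i j : Fin 3) => ∫ y, k (x - y.1) * (y.2 i * y.2 j) ∂(empiricalMeasure ((Φ N).flow s z)); let KinDev : Config (N + 1) (Fin 3) T3 → ℝ := fun z => ∫ s in Ioc 0 τ, ∫ x, ∑ i, ∑ j, (Sk s z x i j - Mv s z x i * Mv s z x j / R s z x - (if i = j then R s z x * (2 / 3 * (En s z x / R s z x - ‖Mv s z x‖ ^ 2 / (2 * R s z x ^ 2))) else 0)) * Torus.partialDeriv j (fun y => w s y i) x; Integrable KinDev (localGibbsLaw σ a₀ u₀ θ₀ N (Φ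 N)) ∧ |∫ z, KinDev z ∂(localGibbsLaw σ a₀ u₀ θ₀ N (Φ N))| ≤ ε := by
  sorry

/-- stub COLL — ANNEALED CUT VIRIAL CLOSURE (the (D1)-collisional half). There is `η_c > 0` such that for every band
`0 < η₁ < η_c` and all continuous positive profiles there is `σ₀` with: for `0 < σ < σ₀`, every flow family, `T' > 0`,
smooth `w` on `[0,T') × 𝕋³`, `T₁ < T'`, `ε > 0` there is `ℓ > 0` such that for every continuous probability kernel
in the `ℓ`-ball, eventually in `N`, for all `τ ∈ [0,T₁]`: `CollDev(z) = C_w(z) − ∫_{(0,τ]}∫ ρ^kθ^k (Z(min(ρ^kσ³,η₁)) − 1) div w`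
is integrable under the local Gibbs law with `|E CollDev| ≤ ε`, where `C_w(z) = Σ_{t_c ∈ (0,τ]}` jump at `t_c` of
`(N+1)⁻¹ Σ_a ⟪∫ k(x − q_a) w(t_c,x) dx, v_a⟫` along the orbit of `z` (prelude `collisionTimes`/`collisionJump`/
`momentumObservable`) is the time-integrated collisional momentum transfer tested against the mollified field, and
`Z = hsCompressibility` is touched only on `[0,η₁]` (inside the analytic band once `η_c ≤` the `HsEosLowDensity`
radius). Why plausibly true: at a binary contact the jump is `⟪(k̃⋆w)(qᵢ) − (k̃⋆w)(qⱼ), Δvᵢ⟫ ≈ σ_N (n·∇)(k̃⋆w)·Δvᵢ`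
(contact Taylor form, landed for time slices: `stub_collisionalStressContactRemainder`, `…TransferMeanBound`,
`…VirialSplit`), and the contact-value virial theorem in local equilibrium (Spohn1991 I (3.15): collision rate ×
mean transfer = `ρθ(Z(ρσ³) − 1)𝟙`) identifies its law average below the band; `|E CollDev| = O(σ³)` a priori. Why
it might fail: persistent pre-collisional correlations at fixed reduced density biasing the contact statistics
(no Boltzmann-hypothesis substitute: `BoltzmannHypothesisBarrierNarrow`, `MacroErgodicityBarrier`); windows above
the band (rattler pressure `ρθ(Z(ρσ³) − Z(η₁)) > 0`, implosion corner of route ImplosionLoophole's `DenseExcursion`)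
must be flux-negligible IN MEAN for all times in the untied frame; needs an a-priori mean collision-rate bound out
of equilibrium (the dropped line's RS/FLUX stub; equilibrium case landed `integral_abs_avg_momentumTransfer_le_const`).
Size: open-problem. -/
theorem stub_collisionalCutVirialMean : ∃ ηc : ℝ, 0 < ηc ∧ ∀ η₁ : ℝ, 0 < η₁ → η₁ < ηc → ∀ (a₀ θ₀ : T3 → ℝ) (u₀ : T3 → V3), Continuous a₀ → Continuous θ₀ → Continuous u₀ → (∀ x, 0 < a₀ x) → (∀ x, 0 < θ₀ x) → ∃ σ₀ : ℝ, 0 < σ₀ ∧ ∀ σ : ℝ, 0 < σ → σ < σ₀ → ∀ Φ : (N : ℕ) → HardSphereFlow (Torus.geometry (Fin 3)) (hsDiameter σ N) (N + 1), ∀ T' : ℝ, 0 < T' → ∀ w : ℝ → T3 → V3, Torus.IsSmoothSpaceTimeOn (Ico 0 T') w → ∀ T₁ : ℝ, 0 ≤ T₁ → T₁ < T' → ∀ ε : ℝ, 0 < ε → ∃ ℓ : ℝ, 0 < ℓ ∧ ∀ k : T3 → ℝ, (Continuous k ∧ (∀ y, 0 ≤ k y) ∧ (∫ y, k y = 1)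 ∧ (∀ y, k y ≠ 0 → Torus.euclidDist y 0 < ℓ)) → ∀ᶠ N in atTop, ∀ τ ∈ Icc 0 T₁, let R := fun s z x => empiricalDensityField ((Φ N).flow s z) (fun y => k (x - y)); let Mv := fun s z x => empiricalMomentumField ((Φ N).flow s z) (fun y => k (x - y)); let En := fun s z x => empiricalEnergyField ((Φ N).flow s z) (fun y => k (x - y)); let Cw : Config (N + 1) (Fin 3) T3 → ℝ := fun z => ∑ᶠ t ∈ collisionTimes (Torus.geometry (Fin 3)) (hsDiameter σ N) (fun s => (Φ N).flow s z) ∩ Ioc 0 τ, collisionJump (fun z' : Config (N + 1) (Fin 3) T3 => ((N + 1 : ℕ) : ℝ)⁻¹ * momentumObservable (fun q => ∫ x, k (x - q) • w t x) z') (fun s => (Φ N).flow s z) t; let CollDev : Config (N + 1) (Fin 3) T3 → ℝ := fun z => Cw z - ∫ s in Ioc 0 τ, ∫ x, R s z x * (2 / 3 * (En s z x / R s z x - ‖Mv s z x‖ ^ 2 / (2 * R s z x ^ 2))) * (hsCompressibility (min (R s z x * σ ^ 3) η₁) - 1) * Torus.divergence (w s) x; Integrable CollDev (localGibbsLaw σ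 a₀ u₀ θ₀ N (Φ N)) ∧ |∫ z, CollDev z ∂(localGibbsLaw σ a₀ u₀ θ₀ N (Φ N))| ≤ ε := by
  sorry

/-- The mean-format triangle inequality behind the glue, in abstract form: if `D = X + Y` `P`-a.e., `X` and `Y`
are integrable with `|∫X| ≤ a`, `|∫Y| ≤ b`, then `D` is integrable and `|∫D| ≤ a + b`. -/
theorem integrable_and_abs_integral_le_of_ae_eq_add {Ω : Type*} [MeasurableSpace Ω] {P : Measure Ω}
    {D X Y : Ω → ℝ} {a b : ℝ} (hsplit : ∀ᵐ z ∂P, D z = X z + Y z)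
    (hX : Integrable X P) (hY : Integrable Y P) (ha : |∫ z, X z ∂P| ≤ a) (hb : |∫ z, Y z ∂P| ≤ b) :
    Integrable D P ∧ |∫ z, D z ∂P| ≤ a + b := by
  have hD : D =ᵐ[P] fun z => X z + Y z := hsplit
  refine ⟨(hX.add hY).congr hD.symm, ?_⟩
  rw [integral_congr_ae hD, integral_add hX hY]
  exact (abs_add_le _ _).trans (add_le_add ha hb)

/-- Shrinking the radius keeps a kernel admissible. -/
theorem kernel_mono {k : T3 → ℝ} {ℓ ℓ' : ℝ} (hℓ : ℓ ≤ ℓ')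
    (hk : Continuous k ∧ (∀ y, 0 ≤ k y) ∧ (∫ y, k y = 1) ∧ (∀ y, k y ≠ 0 → Torus.euclidDist y 0 < ℓ)) :
    Continuous k ∧ (∀ y, 0 ≤ k y) ∧ (∫ y, k y = 1) ∧ (∀ y, k y ≠ 0 → Torus.euclidDist y 0 < ℓ') :=
  ⟨hk.1, hk.2.1, hk.2.2.1, fun y hy => lt_of_lt_of_le (hk.2.2.2 y hy) hℓ⟩

/-- The three parts as named propositions (verbatim the stub signatures). -/
def KernelMomentumBalance : Prop := ∀ (σ η₁ T' : ℝ) (a₀ θ₀ : T3 → ℝ) (u₀ : T3 → V3) (Φ : (N : ℕ) → HardSphereFlow (Torus.geometry (Fin 3)) (hsDiameter σ N) (N + 1)) (k : T3 → ℝ), Continuous k → (∀ y, 0 ≤ k y) → (∫ y, k y = 1) → ∀ w : ℝ → T3 → V3, Torus.IsSmoothSpaceTimeOn (Ico 0 T') w → ∀ τ ∈ Ico 0 T', ∀ N : ℕ, let R := fun s z x => empiricalDensityField ((Φ N).flow s z) (fun y => k (x - y)); let Mv := fun s z x => empiricalMomentumField ((Φ N).flow s z) (fun y => k (x - y)); let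 En := fun s z x => empiricalEnergyField ((Φ N).flow s z) (fun y => k (x - y)); let Sk := fun s z x (i j : Fin 3) => ∫ y, k (x - y.1) * (y.2 i * y.2 j) ∂(empiricalMeasure ((Φ N).flow s z)); let D : Config (N + 1) (Fin 3) T3 → ℝ := fun z => (∫ x, inner ℝ (Mv τ z x) (w τ x)) - (∫ x, inner ℝ (Mv 0 z x) (w 0 x)) - ∫ s in Ioc 0 τ, ∫ x, (inner ℝ (Mv s z x) (Torus.timeDerivWithin (Ico 0 T') w s x) + (∑ i, ∑ j, Mv s z x i * Mv s z x j / R s z x * Torus.partialDeriv j (fun y => w s y i) x) + R s z x * (2 / 3 * (En s z x / R s z x - ‖Mv s z x‖ ^ 2 / (2 * R s z x ^ 2))) * hsCompressibility (min (R s z x * σ ^ 3) η₁) * Torus.divergence (w s) x); let KinDev : Config (N + 1) (Fin 3) T3 → ℝ := fun z => ∫ s in Ioc 0 τ, ∫ x, ∑ i, ∑ j, (Sk s z x i j - Mv s z x i * Mv s z x j / R s z x - (if i = j then R s z x * (2 / 3 * (En s z x / R s z x - ‖Mv s z x‖ ^ 2 / (2 * R s z x ^ 2))) else 0)) * Torus.partialDeriv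 j (fun y => w s y i) x; let Cw : Config (N + 1) (Fin 3) T3 → ℝ := fun z => ∑ᶠ t ∈ collisionTimes (Torus.geometry (Fin 3)) (hsDiameter σ N) (fun s => (Φ N).flow s z) ∩ Ioc 0 τ, collisionJump (fun z' : Config (N + 1) (Fin 3) T3 => ((N + 1 : ℕ) : ℝ)⁻¹ * momentumObservable (fun q => ∫ x, k (x - q) • w t x) z') (fun s => (Φ N).flow s z) t; let CollDev : Config (N + 1) (Fin 3) T3 → ℝ := fun z => Cw z - ∫ s in Ioc 0 τ, ∫ x, R s z x * (2 / 3 * (En s z x / R s z x - ‖Mv s z x‖ ^ 2 / (2 * R s z x ^ 2))) * (hsCompressibility (min (R s z x * σ ^ 3) η₁) - 1) * Torus.divergence (w s) x; ∀ z ∈ (Φ N).good, D z = CollDev z + KinDev z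

/-- See `stub_kineticDeviatorMean`. -/
def KineticDeviatorMean : Prop := ∀ (a₀ θ₀ : T3 → ℝ) (u₀ : T3 → V3), Continuous a₀ → Continuous θ₀ → Continuous u₀ → (∀ x, 0 < a₀ x) → (∀ x, 0 < θ₀ x) → ∃ σ₀ : ℝ, 0 < σ₀ ∧ ∀ σ : ℝ, 0 < σ → σ < σ₀ → ∀ Φ : (N : ℕ) → HardSphereFlow (Torus.geometry (Fin 3)) (hsDiameter σ N) (N + 1), ∀ T' : ℝ, 0 < T' → ∀ w : ℝ → T3 → V3, Torus.IsSmoothSpaceTimeOn (Ico 0 T') w → ∀ T₁ : ℝ, 0 ≤ T₁ → T₁ < T' → ∀ ε : ℝ, 0 < ε → ∃ ℓ : ℝ, 0 < ℓ ∧ ∀ k : T3 → ℝ, (Continuous k ∧ (∀ y, 0 ≤ k y) ∧ (∫ y, k y = 1) ∧ (∀ y, k y ≠ 0 → Torus.euclidDist y 0 < ℓ)) → ∀ᶠ N in atTop, ∀ τ ∈ Icc 0 T₁, let R := fun s z x => empiricalDensityField ((Φ N).flow s z) (fun y => k (x - y)); let Mv := fun s z x => empiricalMomentumField ((Φ N).flow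 s z) (fun y => k (x - y)); let En := fun s z x => empiricalEnergyField ((Φ N).flow s z) (fun y => k (x - y)); let Sk := fun s z x (i j : Fin 3) => ∫ y, k (x - y.1) * (y.2 i * y.2 j) ∂(empiricalMeasure ((Φ N).flow s z)); let KinDev : Config (N + 1) (Fin 3) T3 → ℝ := fun z => ∫ s in Ioc 0 τ, ∫ x, ∑ i, ∑ j, (Sk s z x i j - Mv s z x i * Mv s z x j / R s z x - (if i = j then R s z x * (2 / 3 * (En s z x / R s z x - ‖Mv s z x‖ ^ 2 / (2 * R s z x ^ 2))) else 0)) * Torus.partialDeriv j (fun y => w s y i) x; Integrable KinDev (localGibbsLaw σ a₀ u₀ θ₀ N (Φ N)) ∧ |∫ z, KinDev z ∂(localGibbsLaw σ a₀ u₀ θ₀ N (Φ N))| ≤ ε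

/-- See `stub_collisionalCutVirialMean`. -/
def CollisionalCutVirialMean : Prop := ∃ ηc : ℝ, 0 < ηc ∧ ∀ η₁ : ℝ, 0 < η₁ → η₁ < ηc → ∀ (a₀ θ₀ : T3 → ℝ) (u₀ : T3 → V3), Continuous a₀ → Continuous θ₀ → Continuous u₀ → (∀ x, 0 < a₀ x) → (∀ x, 0 < θ₀ x) → ∃ σ₀ : ℝ, 0 < σ₀ ∧ ∀ σ : ℝ, 0 < σ → σ < σ₀ → ∀ Φ : (N : ℕ) → HardSphereFlow (Torus.geometry (Fin 3)) (hsDiameter σ N) (N + 1), ∀ T' : ℝ, 0 < T' → ∀ w : ℝ → T3 → V3, Torus.IsSmoothSpaceTimeOn (Ico 0 T') w → ∀ T₁ : ℝ, 0 ≤ T₁ → T₁ < T' → ∀ ε : ℝ, 0 < ε → ∃ ℓ : ℝ, 0 < ℓ ∧ ∀ k : T3 → ℝ, (Continuous k ∧ (∀ y, 0 ≤ k y) ∧ (∫ y, k y = 1) ∧ (∀ y, k y ≠ 0 → Torus.euclidDist y 0 < ℓ)) → ∀ᶠ N in atTop, ∀ τ ∈ Icc 0 T₁, let R := fun s z x =>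 empiricalDensityField ((Φ N).flow s z) (fun y => k (x - y)); let Mv := fun s z x => empiricalMomentumField ((Φ N).flow s z) (fun y => k (x - y)); let En := fun s z x => empiricalEnergyField ((Φ N).flow s z) (fun y => k (x - y)); let Cw : Config (N + 1) (Fin 3) T3 → ℝ := fun z => ∑ᶠ t ∈ collisionTimes (Torus.geometry (Fin 3)) (hsDiameter σ N) (fun s => (Φ N).flow s z) ∩ Ioc 0 τ, collisionJump (fun z' : Config (N + 1) (Fin 3) T3 => ((N + 1 : ℕ) : ℝ)⁻¹ * momentumObservable (fun q => ∫ x, k (x - q) • w t x) z') (fun s => (Φ N).flow s z) t; let CollDev : Config (N + 1) (Fin 3) T3 → ℝ := fun z => Cw z - ∫ s in Ioc 0 τ, ∫ x, R s z x * (2 / 3 * (En s z x / R s z x - ‖Mv s z x‖ ^ 2 / (2 * R s z x ^ 2))) * (hsCompressibility (min (R s z x * σ ^ 3) η₁) - 1) * Torus.divergence (w s) x; Integrable CollDev (localGibbsLaw σ a₀ u₀ θ₀ N (Φ N)) ∧ |∫ z, CollDev z ∂(localGibbsLaw σ a₀ u₀ θ₀ N (Φ N))| ≤ ε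

/-- Sanity: the crux restated with this file's `open`s is the route decl, definitionally. -/
example : (∃ ηc : ℝ, 0 < ηc ∧ ∀ η₁ : ℝ, 0 < η₁ → η₁ < ηc → ∀ (a₀ θ₀ : T3 → ℝ) (u₀ : T3 → V3), Continuous a₀ → Continuous θ₀ → Continuous u₀ → (∀ x, 0 < a₀ x) → (∀ x, 0 < θ₀ x) → ∃ σ₀ : ℝ, 0 < σ₀ ∧ ∀ σ : ℝ, 0 < σ → σ < σ₀ → ∀ Φ : (N : ℕ) → HardSphereFlow (Torus.geometry (Fin 3)) (hsDiameter σ N) (N + 1), ∀ T' : ℝ, 0 < T' → ∀ w : ℝ → T3 → V3, Torus.IsSmoothSpaceTimeOn (Ico 0 T') w → ∀ T₁ : ℝ, 0 ≤ T₁ → T₁ < T' → ∀ ε : ℝ, 0 < ε → ∃ ℓ : ℝ, 0 < ℓ ∧ ∀ k : T3 → ℝ, (Continuous k ∧ (∀ y, 0 ≤ k y) ∧ (∫ y, k y = 1) ∧ (∀ y, k y ≠ 0 → Torus.euclidDist y 0 < ℓ)) → ∀ᶠ N in atTop, ∀ τ ∈ Icc 0 T₁, let R := fun s z x => empiricalDensityField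 ((Φ N).flow s z) (fun y => k (x - y)); let Mv := fun s z x => empiricalMomentumField ((Φ N).flow s z) (fun y => k (x - y)); let En := fun s z x => empiricalEnergyField ((Φ N).flow s z) (fun y => k (x - y)); let D : Config (N + 1) (Fin 3) T3 → ℝ := fun z => (∫ x, inner ℝ (Mv τ z x) (w τ x)) - (∫ x, inner ℝ (Mv 0 z x) (w 0 x)) - ∫ s in Ioc 0 τ, ∫ x, (inner ℝ (Mv s z x) (Torus.timeDerivWithin (Ico 0 T') w s x) + (∑ i, ∑ j, Mv s z x i * Mv s z x j / R s z x * Torus.partialDeriv j (fun y => w s y i) x) + R s z x * (2 / 3 * (En s z x / R s z x - ‖Mv s z x‖ ^ 2 / (2 * R s z x ^ 2))) * hsCompressibility (min (R s z x * σ ^ 3) η₁) * Torus.divergence (w s) x); Integrable D (localGibbsLaw σ a₀ u₀ θ₀ N (Φ N)) ∧ |∫ z, D z ∂(localGibbsLaw σ a₀ u₀ θ₀ N (Φ N))| ≤ ε) ↔ MeanMomentumClosureCut := Iff.rfl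

set_option maxHeartbeats 800000 in
/-- THE GLUE, PROVED: the crux follows from the exact balance (BAL), annealed kinetic isotropy (KIN) and the
annealed cut virial closure (COLL). Thresholds: `η_c` from COLL; `σ₀ := min`; `ℓ := min` (a kernel in the smaller
ball is admissible for both); the two `∀ᶠ N` intersected; `ε/2 + ε/2`. The split holds `P_N`-a.e. since the local
Gibbs law is carried by the good set (`DeviatoricStressClosure.ae_mem_good_localGibbsLaw`). -/
theorem parts_imply_meanMomentumClosureCut :
    KernelMomentumBalance → KineticDeviatorMean → CollisionalCutVirialMean → MeanMomentumClosureCut := by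
  intro hB hK hV
  obtain ⟨c₂, hc₂, H₂⟩ := hV
  refine ⟨c₂, hc₂, ?_⟩
  intro η₁ hη₁ hη₁c a₀ θ₀ u₀ ha hθ hu ha0 hθ0
  obtain ⟨s₁, hs₁, G₁⟩ := hK a₀ θ₀ u₀ ha hθ hu ha0 hθ0
  obtain ⟨s₂, hs₂, G₂⟩ := H₂ η₁ hη₁ hη₁c a₀ θ₀ u₀ ha hθ hu ha0 hθ0
  refine ⟨min s₁ s₂, lt_min hs₁ hs₂, ?_⟩
  intro σ hσ hσlt Φ T' hT' w hw T₁ hT₁ hT₁T ε hε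
  obtain ⟨ℓ₁, hℓ₁, K₁⟩ :=
    G₁ σ hσ (lt_of_lt_of_le hσlt (min_le_left _ _)) Φ T' hT' w hw T₁ hT₁ hT₁T (ε / 2) (half_pos hε)
  obtain ⟨ℓ₂, hℓ₂, K₂⟩ :=
    G₂ σ hσ (lt_of_lt_of_le hσlt (min_le_right _ _)) Φ T' hT' w hw T₁ hT₁ hT₁T (ε / 2) (half_pos hε)
  refine ⟨min ℓ₁ ℓ₂, lt_min hℓ₁ hℓ₂, ?_⟩
  intro k hk
  have hk₁ := kernel_mono (min_le_left ℓ₁ ℓ₂) hk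
  have hk₂ := kernel_mono (min_le_right ℓ₁ ℓ₂) hk
  filter_upwards [K₁ k hk₁, K₂ k hk₂] with N hKN hVN
  intro τ hτ
  have A := hKN τ hτ
  have B := hVN τ hτ
  have C := hB σ η₁ T' a₀ θ₀ u₀ Φ k hk.1 hk.2.1 hk.2.2.1 w hw τ ⟨hτ.1, lt_of_le_of_lt hτ.2 hT₁T⟩ N
  dsimp only at A B C ⊢
  have hsplit := (Summit.AtomisticToContinuum.HydrodynamicLimit.Theorems.DeviatoricStressClosure.ae_mem_good_localGibbsLaw
      σ a₀ u₀ θ₀ N (Φ N)).1.mono C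
  obtain ⟨hI, hle⟩ := integrable_and_abs_integral_le_of_ae_eq_add hsplit B.1 A.1 B.2 A.2
  exact ⟨hI, hle.trans_eq (add_halves ε)⟩

/-- THE SKELETON THEOREM: concludes the crux `MeanMomentumClosureCut` BY NAME with no hypotheses, from the three
registered stubs through the proved glue; its only `sorryAx` dependence is through `stub_kernelMomentumBalance` /
`stub_kineticDeviatorMean` / `stub_collisionalCutVirialMean`. -/
theorem MeanMomentumClosureCut_of : MeanMomentumClosureCut :=
  parts_imply_meanMomentumClosureCut stub_kernelMomentumBalance stub_kineticDeviatorMean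
    stub_collisionalCutVirialMean

end Summit.AtomisticToContinuum.HydrodynamicLimit.Cruxes.MeanMomentumClosureCut.BalanceSplit
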